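import Literature.MathematicalPhysics.QuantumFieldTheory.MullerSchiemann1987.MS87Theorem3Climb
import Literature.MathematicalPhysics.QuantumFieldTheory.MullerSchiemann1987.MS87PositiveTypeIterates
import HarnessLib

/-!
# Müller–Schiemann, *Continuum limit of a hierarchical SU(2) lattice gauge theory in 4 dimensions*
# (CMP 110, 1987), Theorem 3: the structural hypotheses of the printed climb (`𝒢` and positive type AT EVERY SCALE)
# REDUCED TO THE INITIAL GIBBS FACTORS `g_N^{(−N)}` — «this property iterates too» (p.263) along the cutoff families
# (theorems only; no definition, no named fact)

statement-level skeleton of published theorems with citation tags; proofs where landed; nothing here is a claim about the Yang–Mills mass gap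

**Citation header (reproduction of PUBLISHED work).** V. F. Müller, J. Schiemann, *Continuum limit of a hierarchical
SU(2) lattice gauge theory in 4 dimensions*, Commun. Math. Phys. **110** (1987) 261–286, doi 10.1007/BF01207367
[MullerSchiemann1987]; p.263 L.29–37 ((2.1)–(2.3) «valid for n ∈ ℕ₀»; «Usually g⁽⁰⁾(u) is chosen as a function of
positive type; this property iterates too, see (I)»), Theorem 3 p.282 and its proof p.282 L.29 – p.283 L.37, (6.17) p.281
(«the sequence g_N^{(−n)}, n fixed, N ∈ ℕ, N ≥ n» generated from the initial factors by the recursion). Held Project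
Euclid scan `paper:url-96df5da18d4c` (renders `run/shared/lean/pub/lit-balaban/lit-balaban-p12/renders-cmp110ms/`).
Lean lane of the lit-balaban YM LIT SWEEP CONTEXT row X1 (register level; zero weight for any token of that table); the
model is the `d = 4` HIERARCHICAL `SU(2)` gauge model, NOT lattice Yang–Mills.

**What this file proves (kernel-checked, 0 sorry).** For a doubly indexed family `g N n` (`n ≤ N`: the Gibbs factor at
scale `n` with cutoff `N`) linked by Migdal's recursion `𝒯_r (g N (n+1)) = g N n` (the sibling `MS87Theorem3Climb`'s
`hrec`), on any compact group:
* §1 `g N n = 𝒯_r^{N−n} (g N N)` (`eq_iterate_of_rec`); hence **`g N n ∈ 𝒢` for all `n ≤ N` as soon as the INITIAL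
  factor `g N N ∈ 𝒢`** (`inG_of_initial`, the sibling `PositiveTypeIterates.inG_iterate_migdal`), and, for EVEN `r`,
  **`g N n` is of positive type for all `n ≤ N` as soon as `g N N ∈ 𝒢` is of positive type** (`positiveType_of_initial`,
  the sibling `positiveType_iterate_migdal'`; positive type ⟹ (2.3), positive definite kernels being symmetric).
* §2 `G = SU(2)`: **THEOREM 3 by the printed climb with the structural hypotheses at the initial scale only**
  (`theorem3_climb_initial`): the sibling `Theorem3Climb.theorem3_climb` with its hypotheses `hG`, `hpos` (all scales)
  replaced by `InG (g N N)` and positive type of `g N N` (all cutoffs `N`), for even `r = 2(a+1)` (the paper's `r = 2`,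
  `r = 4`); property (ii) stays the hypothesis `hii` here (it is discharged in the sibling `MS87MigdalInjective`).

**Not claimed.** Property (ii) (see `MS87MigdalInjective`), Theorems 1, 2, 4; anything about lattice Yang–Mills.
-/

noncomputable section

open Filter Set Function
open scoped Topology

namespace Literature.MathematicalPhysics.QuantumFieldTheory

namespace MullerSchiemann1987

namespace Theorem3InitialData

open Literature.Analysis.Matrix (IsPosDefKernel)
open Migdal (InG migdal IsSymm)
open PositiveTypeIterates (inG_iterate_migdal positiveType_iterate_migdal')
open HeatKernel (u0)
open Theorem3Climb (theorem3_climb)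

section General

variable {G : Type*} [Group G] [TopologicalSpace G] [IsTopologicalGroup G] [CompactSpace G]
  [MeasurableSpace G] [BorelSpace G]

/-- **The cutoff family is generated from its initial factor**: if `𝒯_r (g N (n+1)) = g N n` for all `n + 1 ≤ N`,
then `g N n = 𝒯_r^{N−n} (g N N)` for all `n ≤ N` ((6.17): «g_N^{(−n)} … generated by the recursion»).
[cite: MullerSchiemann1987, (6.17) p.281, (3.1) p.266] -/
theorem eq_iterate_of_rec (r : ℕ) {g : ℕ → ℕ → G → ℝ} (hrec : ∀ N n, n + 1 ≤ N → migdal r (g N (n + 1)) = g N n)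
    (N : ℕ) : ∀ n, n ≤ N → g N n = (migdal r)^[N - n] (g N N) := by
  -- induction on `k = N - n`
  suffices h : ∀ k, k ≤ N → g N (N - k) = (migdal r)^[k] (g N N) by
    intro n hn
    have := h (N - n) (Nat.sub_le N n)
    rwa [Nat.sub_sub_self hn] at this
  intro k
  induction k with
  | zero => intro _; simp
  | succ k ih =>
      intro hk
      have hk' : k ≤ N := Nat.le_of_succ_le hk
      rw [Function.iterate_succ_apply', ← ih hk']
      have h1 : N - (k + 1) + 1 ≤ N := by omega
      have h2 : N - (k + 1) + 1 = N - k := by omega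
      rw [← hrec N (N - (k + 1)) h1, h2]

/-- **«valid for n ∈ ℕ₀» — `𝒢` at every scale from `𝒢` at the initial scale**: if every initial factor `g N N ∈ 𝒢`
and the family is linked by `𝒯_r`, then `g N n ∈ 𝒢` for all `n ≤ N`.
[cite: MullerSchiemann1987, (2.1)–(2.2) p.263 («valid for n ∈ ℕ₀»), p.283 L.27–28] -/
theorem inG_of_initial (r : ℕ) {g : ℕ → ℕ → G → ℝ} (hrec : ∀ N n, n + 1 ≤ N → migdal r (g N (n + 1)) = g N n)
    (hinit : ∀ N, InG (g N N)) : ∀ N n, n ≤ N → InG (g N n) := by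
  intro N n hn
  rw [eq_iterate_of_rec r hrec N n hn]
  exact inG_iterate_migdal r (hinit N) (N - n)

/-- **«this property iterates too» — positive type at every scale from positive type at the initial scale** (even
`r = 2(a+1)`: the paper's `r = 2` and `r = 4`): if every initial factor `g N N ∈ 𝒢` is of positive type and the family
is linked by `𝒯_r`, then every `g N n`, `n ≤ N`, is of positive type. [cite: MullerSchiemann1987, p.263 L.34–37] -/
theorem positiveType_of_initial [T2Space G] (a : ℕ) {g : ℕ → ℕ → G → ℝ}
    (hrec : ∀ N n, n + 1 ≤ N → migdal (2 * (a + 1)) (g N (n + 1)) = g N n) (hinit : ∀ N, InG (g N N))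
    (hpos : ∀ N, IsPosDefKernel fun u v : G => g N N (u⁻¹ * v)) :
    ∀ N n, n ≤ N → IsPosDefKernel fun u v : G => g N n (u⁻¹ * v) := by
  intro N n hn
  rw [eq_iterate_of_rec (2 * (a + 1)) hrec N n hn]
  -- positive definite kernels are symmetric, so `g N N` satisfies (2.3)
  have hs : IsSymm (g N N) := fun u => by simpa using (hpos N).1 u 1
  exact positiveType_iterate_migdal' (hinit N) hs a (hpos N) (N - n)

end General

/-! ## §2 `G = SU(2)`: THEOREM 3's printed climb with the structural hypotheses at the initial scale only -/

section SU2

/-- **THEOREM 3 by the printed climb, structural hypotheses at the initial scale** (the sibling `theorem3_climb` with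
`hG`, `hpos` for all scales DERIVED from the initial Gibbs factors `g_N^{(−N)} ∈ 𝒢` of positive type — «this property
iterates too», p.263 — for even `r = 2(a+1)`; property (ii) is the hypothesis `hii`, discharged in the sibling
`MS87MigdalInjective`). For the cutoff families on `SU(2)` (`h_N^{(−n)}` holomorphic and bounded by `M_n` on
`{|Im z| < d_n}` (6.18), even, `2π`-periodic; `g_N^{(−n)} = h_N^{(−n)} ∘ (arccos ∘ u₀)`; `𝒯_r g_N^{(−n−1)} = g_N^{(−n)}`)
and ANY strictly increasing cutoff sequence `N_j` along which the scale-`0` functions converge locally uniformly,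
`h_{N_j}^{(−n)}` converges locally uniformly on `{|Im z| < d_n}` for EVERY `n`.
[cite: MullerSchiemann1987, Thm 3 p.282, proof p.282 L.29 – p.283 L.37, p.263 L.29–37] -/
theorem theorem3_climb_initial (a : ℕ) {d M : ℕ → ℝ} (hd : ∀ n, 0 < d n)
    {h : ℕ → ℕ → ℂ → ℂ} {g : ℕ → ℕ → Matrix.specialUnitaryGroup (Fin 2) ℂ → ℝ}
    (hhol : ∀ N n, n ≤ N → DifferentiableOn ℂ (h N n) {z : ℂ | |z.im| < d n})
    (hbd : ∀ N n, n ≤ N → ∀ z : ℂ, |z.im| < d n → ‖h N n z‖ ≤ M n)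
    (hper : ∀ N n, n ≤ N → Function.Periodic (h N n) (2 * Real.pi))
    (heven : ∀ N n, n ≤ N → ∀ z, h N n (-z) = h N n z)
    (hgh : ∀ N n, n ≤ N → ∀ U, (g N n U : ℂ) = h N n (Real.arccos (u0 U)))
    (hinit : ∀ N, InG (g N N)) (hpos : ∀ N, IsPosDefKernel fun u v => g N N (u⁻¹ * v))
    (hrec : ∀ N n, n + 1 ≤ N → migdal (2 * (a + 1)) (g N (n + 1)) = g N n)
    (hii : ∀ g₁ g₂ : Matrix.specialUnitaryGroup (Fin 2) ℂ → ℝ, InG g₁ → InG g₂ →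
      IsPosDefKernel (fun u v => g₁ (u⁻¹ * v)) → IsPosDefKernel (fun u v => g₂ (u⁻¹ * v)) →
      migdal (2 * (a + 1)) g₁ = migdal (2 * (a + 1)) g₂ → g₁ = g₂)
    {Nj : ℕ → ℕ} (hNj : StrictMono Nj) {f₀ : ℂ → ℂ}
    (h0 : TendstoLocallyUniformlyOn (fun j => h (Nj j) 0) f₀ atTop {z : ℂ | |z.im| < d 0}) :
    ∀ n, ∃ f : ℂ → ℂ, DifferentiableOn ℂ f {z : ℂ | |z.im| < d n} ∧
      TendstoLocallyUniformlyOn (fun j => h (Nj j) n) f atTop {z : ℂ | |z.im| < d n} :=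
  theorem3_climb (2 * (a + 1)) hd hhol hbd hper heven hgh (inG_of_initial _ hrec hinit)
    (positiveType_of_initial a hrec hinit hpos) hrec hii hNj h0

end SU2

end Theorem3InitialData

end MullerSchiemann1987

end Literature.MathematicalPhysics.QuantumFieldTheory
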